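import Mathlib
import Summits.KontsevichZagierPeriods.KontsevichZagierPeriods.Theorems.SoloInformedKappaExact
import Summits.KontsevichZagierPeriods.KontsevichZagierPeriods.Theorems.SoloInformedArcPieces
import Literature.NumberTheory.Transcendental.CurvePeriodsTransportProofs
import HarnessLib

/-!
# Solo-informed: `κ` kills the elementary relations — Rung 2 from (APPROX), (HI), (R4), (R5)

File J6 of the `κ`-side of Rung 2 (`paper/rung2-v2.md` §5–6): the top-level logic. With the
functional `κ = κ̃ ∘ N` of `SoloInformedKappaHomotopy.lean` (defined from a Nash-replacement
hypothesis (APPROX) = `SoloInformedNashApprox`, and well behaved under the homotopy-invariance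
hypothesis (HI) = `SoloInformedNashHI`), the six Huber–Wüstholz elementary relations are killed as
follows: (R1a), (R1b), (R2) by `SoloInformedKappaOmega.lean`/`SoloInformedKappaHomotopy.lean`
(integrand additivity, algebraic scaling, vanishing integrands — unconditionally in the path);
(R3) by `SoloInformedKappaExact.lean` (Newton–Leibniz along the Nash replacement); (R4)
functoriality and (R5) boundaries of `C¹` triangles are isolated here as the standing propositions
`SoloInformedKappaR4`, `SoloInformedKappaR5` (targets of files J4, J5).

* `soloInformed_linearCombination_kappa_eq_zero` — case analysis of `IsElementaryRelation`,
  transported to `ℚ̄`-coefficients by injectivity of `soloInformedCoeFinsupp`;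
* `soloInformed_kappaKills_of` — **(APPROX) → (HI) → (R4) → (R5) → KappaKills**;
* `soloInformed_volumeRung_two_of_nash` — with `soloInformed_planarPieces` (file E5b, proved) and
  `soloInformed_volumeRung_two_of` (file C): **Rung 2 of the volume ladder follows from the
  Huber–Wüstholz theorem and the four path-side statements (APPROX), (HI), (R4), (R5).**

References: Huber–Wüstholz, *Transcendence and linear relations of 1-periods* (2022), Thm. 13.3;
Kontsevich–Zagier, *Periods* (2001), §1.2.
-/

noncomputable section

open scoped unitInterval
open MeasureTheory Set MvPolynomial
open Literature.NumberTheory.Transcendental Literature.NumberTheory.Transcendental.KZ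
open Literature.NumberTheory.Transcendental.CurvePeriods
open Literature.ModelTheory.ExponentialFields

namespace Summit.KontsevichZagierPeriods.KontsevichZagierPeriods.Theorems

/-! ## 1. The two remaining path-side statements -/

/-- **(R4) for `κ`** — functoriality along polynomial maps of pairs `f : Z → Z′` over `ℚ̄`:
`κ(Z, f^*ω′, γ) = κ(Z′, ω′, f ∘ γ)`. (Target of file J4: the image of a Nash path under a polynomial
map with algebraic coefficients is Nash, the integrands agree pointwise by the chain rule, and (HI)
moves the Nash replacements.) [Huber–Wüstholz 2022, §13.1 (B)] -/
def SoloInformedKappaR4 (hA : SoloInformedNashApprox) : Prop :=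
  ∀ (Z Z' : CurveData) (hZ : Z.IsSmoothAffineCurve) (hZ' : Z'.IsSmoothAffineCurve)
    (f : Fin Z'.n → MvPolynomial (Fin Z.n) ℂ), (∀ j, HasAlgCoeffs (f j)) →
    (∀ z ∈ Z.points, (fun j => eval z (f j)) ∈ Z'.points) →
    ∀ (ω' : Fin Z'.n → MvPolynomial (Fin Z'.n) ℂ) (h' : ∀ j, HasAlgCoeffs (ω' j))
      (ω : Fin Z.n → MvPolynomial (Fin Z.n) ℂ) (h : ∀ i, HasAlgCoeffs (ω i)),
      ω = formPullback f ω' → ∀ (γ : CurvePath Z) (γ' : CurvePath Z'),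
      (∀ t ∈ Icc (0 : ℝ) 1, γ'.toFun t = fun j => eval (γ.toFun t) (f j)) →
      soloInformedKappa hA ⟨Z, hZ, ω, h, γ⟩ = soloInformedKappa hA ⟨Z', hZ', ω', h', γ'⟩

/-- **(R5) for `κ`** — boundaries of `C¹` triangles `τ : Δ → Z` with algebraic vertices:
`κ(Z, ω, e₀₁) + κ(Z, ω, e₁₂) = κ(Z, ω, e₀₂)`. (Target of file J5: additivity of `κ̃` under
concatenation of Nash paths and homotopy invariance across the triangle.)
[Huber–Wüstholz 2022, §3.3.1] -/
def SoloInformedKappaR5 (hA : SoloInformedNashApprox) : Prop :=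
  ∀ (Z : CurveData) (hZ : Z.IsSmoothAffineCurve) (ω : Fin Z.n → MvPolynomial (Fin Z.n) ℂ)
    (h : ∀ i, HasAlgCoeffs (ω i)) (τ : ℝ × ℝ → (Fin Z.n → ℂ)), ContDiffOn ℝ 1 τ stdTriangle →
    MapsTo τ stdTriangle Z.points → ∀ (e₀₁ e₁₂ e₀₂ : CurvePath Z),
    (∀ t ∈ Icc (0 : ℝ) 1, e₀₁.toFun t = τ (t, 0)) →
    (∀ t ∈ Icc (0 : ℝ) 1, e₁₂.toFun t = τ (1 - t, t)) →
    (∀ t ∈ Icc (0 : ℝ) 1, e₀₂.toFun t = τ (0, t)) →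
      soloInformedKappa hA ⟨Z, hZ, ω, h, e₀₁⟩ + soloInformedKappa hA ⟨Z, hZ, ω, h, e₁₂⟩ =
        soloInformedKappa hA ⟨Z, hZ, ω, h, e₀₂⟩

/-! ## 2. Transport of combinations along `ℚ̄ ↪ ℂ` -/

/-- `soloInformedCoeFinsupp` on a `single`. -/
@[simp] theorem soloInformedCoeFinsupp_single (s : PeriodSymbol) (a : SoloInformedCxAlg) :
    soloInformedCoeFinsupp (Finsupp.single s a) = Finsupp.single s (a : ℂ) := by
  classical
  ext s'
  simp only [soloInformedCoeFinsupp_apply, Finsupp.single_apply]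
  split_ifs <;> simp

/-- `soloInformedCoeFinsupp` is compatible with subtraction. -/
theorem soloInformedCoeFinsupp_sub (ρ ρ' : PeriodSymbol →₀ SoloInformedCxAlg) :
    soloInformedCoeFinsupp (ρ - ρ') = soloInformedCoeFinsupp ρ - soloInformedCoeFinsupp ρ' := by
  ext s; simp

/-! ## 3. `κ` kills every elementary relation -/

/-- **`κ` vanishes, `ℚ̄`-linearly extended, on every elementary relation with algebraic
coefficients** (given (APPROX), (HI), (R4), (R5)). The six cases of `IsElementaryRelation`:
(R1a) `soloInformedKappa_add_form`, (R1b) `soloInformedKappa_smul_form`,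
(R2) `soloInformedKappa_eq_zero_of_vanishesOn`, (R3) `soloInformedKappa_exact`, (R4), (R5).
[Huber–Wüstholz 2022, Thm. 13.3; paper/rung2-v2.md §5] -/
theorem soloInformed_linearCombination_kappa_eq_zero (hA : SoloInformedNashApprox)
    (hI : SoloInformedNashHI) (h4 : SoloInformedKappaR4 hA) (h5 : SoloInformedKappaR5 hA)
    (ρ : PeriodSymbol →₀ SoloInformedCxAlg) (hρ : IsElementaryRelation (soloInformedCoeFinsupp ρ)) :
    Finsupp.linearCombination SoloInformedCxAlg (soloInformedKappa hA) ρ = 0 := by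
  generalize hc : soloInformedCoeFinsupp ρ = c at hρ
  have key : ∀ ρ' : PeriodSymbol →₀ SoloInformedCxAlg, soloInformedCoeFinsupp ρ' = c →
      Finsupp.linearCombination SoloInformedCxAlg (soloInformedKappa hA) ρ' = 0 →
      Finsupp.linearCombination SoloInformedCxAlg (soloInformedKappa hA) ρ = 0 := by
    intro ρ' h' h0
    rwa [soloInformedCoeFinsupp_injective (hc.trans h'.symm)]
  cases hρ with
  | add Z hZ γ ω ω₁ ω₂ h h₁ h₂ hω =>
    refine key (Finsupp.single ⟨Z, hZ, ω, h, γ⟩ 1 - Finsupp.single ⟨Z, hZ, ω₁, h₁, γ⟩ 1 -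
      Finsupp.single ⟨Z, hZ, ω₂, h₂, γ⟩ 1) (by simp [soloInformedCoeFinsupp_sub]) ?_
    rw [map_sub, map_sub, Finsupp.linearCombination_single, Finsupp.linearCombination_single,
      Finsupp.linearCombination_single, one_smul, one_smul, one_smul,
      soloInformedKappa_add_form hA Z hZ γ ω ω₁ ω₂ h h₁ h₂ hω]
    abel
  | smul Z hZ γ a ha ω ω' h h' hω =>
    obtain ⟨a', rfl⟩ : ∃ a' : SoloInformedCxAlg, (a' : ℂ) = a :=
      ⟨⟨a, mem_algebraicClosure_iff.mpr ha⟩, rfl⟩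
    refine key (Finsupp.single ⟨Z, hZ, ω', h', γ⟩ 1 - a' • Finsupp.single ⟨Z, hZ, ω, h, γ⟩ 1)
      (by simp [soloInformedCoeFinsupp_sub]) ?_
    rw [map_sub, map_smul, Finsupp.linearCombination_single, Finsupp.linearCombination_single,
      one_smul, one_smul, soloInformedKappa_smul_form hA Z hZ γ a' ω ω' h h' hω, sub_self]
  | vanish Z hZ γ ω h hv =>
    refine key (Finsupp.single ⟨Z, hZ, ω, h, γ⟩ 1) (by simp) ?_
    rw [Finsupp.linearCombination_single, one_smul,
      soloInformedKappa_eq_zero_of_vanishesOn hA Z hZ γ ω h hv]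
  | exact Z hZ γ P hP ω h hω =>
    have hc₀ : IsAlgebraic ℚ (eval (γ.toFun 1) P - eval (γ.toFun 0) P) :=
      (hP.isAlgebraic_eval γ.algebraic_one).sub (hP.isAlgebraic_eval γ.algebraic_zero)
    obtain ⟨c₀, hc₀'⟩ :
        ∃ c₀ : SoloInformedCxAlg, (c₀ : ℂ) = eval (γ.toFun 1) P - eval (γ.toFun 0) P :=
      ⟨⟨_, mem_algebraicClosure_iff.mpr hc₀⟩, rfl⟩
    refine key (Finsupp.single ⟨Z, hZ, ω, h, γ⟩ 1 - c₀ • Finsupp.single PeriodSymbol.unit 1)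
      (by simp [soloInformedCoeFinsupp_sub, hc₀']) ?_
    rw [map_sub, map_smul, Finsupp.linearCombination_single, Finsupp.linearCombination_single,
      one_smul, one_smul, soloInformedKappa_exact hA hI Z hZ γ P hP ω h hω c₀ hc₀', sub_self]
  | pushforward Z Z' hZ hZ' f hf hfZ ω' h' ω h hω γ γ' hγ' =>
    refine key (Finsupp.single ⟨Z, hZ, ω, h, γ⟩ 1 - Finsupp.single ⟨Z', hZ', ω', h', γ'⟩ 1)
      (by simp [soloInformedCoeFinsupp_sub]) ?_
    rw [map_sub, Finsupp.linearCombination_single, Finsupp.linearCombination_single, one_smul,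
      one_smul, h4 Z Z' hZ hZ' f hf hfZ ω' h' ω h hω γ γ' hγ', sub_self]
  | boundary Z hZ ω h τ hτ hτZ e₀₁ e₁₂ e₀₂ h₀₁ h₁₂ h₀₂ =>
    refine key (Finsupp.single ⟨Z, hZ, ω, h, e₀₁⟩ 1 + Finsupp.single ⟨Z, hZ, ω, h, e₁₂⟩ 1 -
      Finsupp.single ⟨Z, hZ, ω, h, e₀₂⟩ 1)
      (by simp [soloInformedCoeFinsupp_sub, soloInformedCoeFinsupp_add]) ?_
    rw [map_sub, map_add, Finsupp.linearCombination_single, Finsupp.linearCombination_single,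
      Finsupp.linearCombination_single, one_smul, one_smul, one_smul,
      h5 Z hZ ω h τ hτ hτZ e₀₁ e₁₂ e₀₂ h₀₁ h₁₂ h₀₂, sub_self]

/-- **(APPROX) → (HI) → (R4) → (R5) → KappaKills.** [paper/rung2-v2.md §4–5] -/
theorem soloInformed_kappaKills_of (hA : SoloInformedNashApprox) (hI : SoloInformedNashHI)
    (h4 : SoloInformedKappaR4 hA) (h5 : SoloInformedKappaR5 hA) : SoloInformedKappaKills :=
  ⟨soloInformedKappa hA, fun s h => soloInformedKappa_eq_kappaTilde hA hI s h,
    fun ρ hρ => soloInformed_linearCombination_kappa_eq_zero hA hI h4 h5 ρ hρ⟩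

/-! ## 4. Rung 2 from the Huber–Wüstholz theorem and the path-side statements -/

/-- **Rung 2 of the volume ladder, conditional form.** The Kontsevich–Zagier period conjecture
for areas of compact planar `ℚ`-semialgebraic regions follows from the Huber–Wüstholz theorem on
1-periods (named fact `HuberWustholzCurvePeriods`, H–W 2022 Thm. 13.3 (2)) together with the four
path-side statements (APPROX) Nash replacement, (HI) homotopy invariance of `κ̃` on Nash paths,
(R4) functoriality and (R5) triangle boundaries for `κ`. The planar side
(`soloInformed_planarPieces`:
every compact planar region is, in `P × P`, a signed sum of `κ̃` of Nash symbols on smooth affine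
curves — cylindrical decomposition, real Puiseux branches, étale resolution of cusps) is proved
unconditionally. [paper/rung2-v2.md §6] -/
theorem soloInformed_volumeRung_two_of_nash (hA : SoloInformedNashApprox) (hI : SoloInformedNashHI)
    (h4 : SoloInformedKappaR4 hA) (h5 : SoloInformedKappaR5 hA)
    (hHW : HuberWustholzCurvePeriods) : SoloInformedVolumeRung 2 :=
  soloInformed_volumeRung_two_of soloInformed_planarPieces (soloInformed_kappaKills_of hA hI h4 h5)
    hHW

end Summit.KontsevichZagierPeriods.KontsevichZagierPeriods.Theorems

/-!
# Solo-informed: (R4) for `κ` — functoriality along polynomial maps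

File J4 of the `κ`-side of Rung 2 (`paper/rung2-v2.md` §5, relation (R4)): the standing
proposition `SoloInformedKappaR4` of `SoloInformedKappaKills.lean` is a THEOREM under (APPROX) and
(HI). For a polynomial map of pairs `f : Z → Z′` over `ℚ̄` and a Nash path `N` on `Z`:

* `soloInformedMapPath` — the image path `f ∘ N : [0,1] → Z′` (a `CurvePath Z′`);
* `soloInformed_isNashPath_mapPath` — `f ∘ N` is Nash (polynomials with algebraic coefficients in
  functions with semialgebraic real/imaginary parts, `SoloInformedReImSA.eval_poly`);
* `soloInformedPathIntegrand_mapPath` — the chain rule: the path integrands of `(Z, f^*ω′, N)` and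
  `(Z′, ω′, f ∘ N)` agree pointwise on `[0,1]`, hence `soloInformedKappaTilde_mapPath`:
  `κ̃(Z, f^*ω′, N) = κ̃(Z′, ω′, f ∘ N)` (same representations up to the integrand on the domain);
* `SoloInformedHomotopic.mapPath` — `f ∘ (·)` preserves homotopy (`Path.Homotopic.map`);
* `soloInformed_kappaR4` — **(R4) for `κ`**: `κ(Z, f^*ω′, γ) = κ̃(Z, f^*ω′, N(Z,γ))
  = κ̃(Z′, ω′, f ∘ N(Z,γ)) = κ̃(Z′, ω′, N(Z′,γ′)) = κ(Z′, ω′, γ′)`, the third step by (HI) since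
  `f ∘ N(Z,γ) ~ f ∘ γ = γ′ ~ N(Z′,γ′)`.

Consequently `soloInformed_volumeRung_two_of_nash'`: Rung 2 from (HW), (APPROX), (HI), (R5).

References: Huber–Wüstholz, *Transcendence and linear relations of 1-periods* (2022), §13.1 (B).
-/


open scoped unitInterval
open MeasureTheory Set MvPolynomial
open Literature.NumberTheory.Transcendental Literature.NumberTheory.Transcendental.KZ
open Literature.NumberTheory.Transcendental.CurvePeriods
open Literature.ModelTheory.ExponentialFields

namespace Summit.KontsevichZagierPeriods.KontsevichZagierPeriods.Theorems

section MapPath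

variable {Z Z' : CurveData} (f : Fin Z'.n → MvPolynomial (Fin Z.n) ℂ)
  (hf : ∀ j, HasAlgCoeffs (f j)) (hfZ : ∀ z ∈ Z.points, (fun j => eval z (f j)) ∈ Z'.points)

/-! ## 1. The image path -/

/-- **The image path `f ∘ γ`** of a `C¹` path under a polynomial map of pairs over `ℚ̄`. -/
def soloInformedMapPath (γ : CurvePath Z) : CurvePath Z' where
  toFun t := fun j => eval (γ.toFun t) (f j)
  contDiffOn := contDiffOn_pi' fun j => contDiffOn_eval_comp γ.contDiffOn (f j)
  mem_points t ht := hfZ _ (γ.mem_points t ht)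
  algebraic_zero j := (hf j).isAlgebraic_eval γ.algebraic_zero
  algebraic_one j := (hf j).isAlgebraic_eval γ.algebraic_one

/-- Values of the image path (definitional). -/
@[simp] theorem soloInformedMapPath_apply (γ : CurvePath Z) (t : ℝ) :
    (soloInformedMapPath f hf hfZ γ).toFun t = fun j => eval (γ.toFun t) (f j) := rfl

/-- **The image of a Nash path under a polynomial map over `ℚ̄` is a Nash path.** -/
theorem soloInformed_isNashPath_mapPath (γ : CurvePath Z) (hN : SoloInformedIsNashPath γ.toFun) :
    SoloInformedIsNashPath (soloInformedMapPath f hf hfZ γ).toFun := by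
  obtain ⟨ε, hε, hcd, hsa⟩ := hN
  have hs := isSemialgebraic_soloInformedIoo1 (-ε) (1 + ε)
  push_cast at hs
  exact ⟨ε, hε, contDiffOn_pi' fun j => contDiffOn_eval_comp hcd (f j),
    fun j => SoloInformedReImSA.eval_poly hs hsa (hf j)⟩

/-! ## 2. The chain rule: equal path integrands -/

/-- **Chain rule for the path integrands**: for a path `γ` which is `C¹` on an open interval
containing `t`, the integrand of `(Z, f^*ω′, γ)` at `t` equals that of `(Z′, ω′, f ∘ γ)`.
[Huber–Wüstholz 2022, §13.1 (B)] -/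
theorem soloInformedPathIntegrand_mapPath (hZ : Z.IsSmoothAffineCurve)
    (hZ' : Z'.IsSmoothAffineCurve) (ω' : Fin Z'.n → MvPolynomial (Fin Z'.n) ℂ)
    (h' : ∀ j, HasAlgCoeffs (ω' j)) (h : ∀ i, HasAlgCoeffs (formPullback f ω' i))
    (γ : CurvePath Z) {a b : ℝ} (hcd : ContDiffOn ℝ 1 γ.toFun (Ioo a b)) {t : ℝ}
    (ht : t ∈ Ioo a b) :
    soloInformedPathIntegrand ⟨Z, hZ, formPullback f ω', h, γ⟩ t =
      soloInformedPathIntegrand ⟨Z', hZ', ω', h', soloInformedMapPath f hf hfZ γ⟩ t := by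
  have hderiv : ∀ j, deriv (fun u => eval (γ.toFun u) (f j)) t =
      ∑ i, eval (γ.toFun t) (pderiv i (f j)) * deriv (fun u => γ.toFun u i) t := fun j =>
    (soloInformed_hasDerivAt_eval_path hcd (f j) ht).deriv
  unfold soloInformedPathIntegrand
  simp only [soloInformedMapPath_apply, hderiv]
  simp_rw [formPullback, map_sum, map_mul, eval_bind₁_eq, Finset.sum_mul, Finset.mul_sum]
  rw [Finset.sum_comm]
  refine Finset.sum_congr rfl fun i _ => Finset.sum_congr rfl fun j _ => ?_
  ring

/-- **`κ̃(Z, f^*ω′, N) = κ̃(Z′, ω′, f ∘ N)`** for a Nash path `N`: the two pairs of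
representations have the same domain `[0,1]` and integrands agreeing on it. -/
theorem soloInformedKappaTilde_mapPath (hZ : Z.IsSmoothAffineCurve)
    (hZ' : Z'.IsSmoothAffineCurve) (ω' : Fin Z'.n → MvPolynomial (Fin Z'.n) ℂ)
    (h' : ∀ j, HasAlgCoeffs (ω' j)) (h : ∀ i, HasAlgCoeffs (formPullback f ω' i))
    (γ : CurvePath Z) (hN : SoloInformedIsNashPath γ.toFun)
    (hN' : SoloInformedIsNashPath (soloInformedMapPath f hf hfZ γ).toFun) :
    soloInformedKappaTilde ⟨Z, hZ, formPullback f ω', h, γ⟩ hN =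
      soloInformedKappaTilde ⟨Z', hZ', ω', h', soloInformedMapPath f hf hfZ γ⟩ hN' := by
  obtain ⟨ε, hε, hcd, -⟩ := id hN
  have hε' : (0 : ℝ) < ε := by exact_mod_cast hε
  have heq : ∀ x ∈ soloInformedUnitI,
      soloInformedPathIntegrand ⟨Z, hZ, formPullback f ω', h, γ⟩ (x 0) =
        soloInformedPathIntegrand ⟨Z', hZ', ω', h', soloInformedMapPath f hf hfZ γ⟩ (x 0) :=
    fun x hx => soloInformedPathIntegrand_mapPath f hf hfZ hZ hZ' ω' h' h γ hcd
      ⟨by linarith [hx.1], by linarith [hx.2]⟩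
  ext
  · rw [soloInformedKappaTilde_fst, soloInformedKappaTilde_fst]
    refine soloInformed_toFormalPeriod_congr_of_eqOn rfl fun x hx => ?_
    simp only [soloInformedPathRepRe_integrand, heq x hx]
  · rw [soloInformedKappaTilde_snd, soloInformedKappaTilde_snd]
    refine soloInformed_toFormalPeriod_congr_of_eqOn rfl fun x hx => ?_
    simp only [soloInformedPathRepIm_integrand, heq x hx]

/-! ## 3. Image paths of homotopic paths are homotopic -/

/-- The polynomial map `f` as a continuous map `Z(ℂ) → Z′(ℂ)`. -/
def soloInformedMapPoints : C(Z.points, Z'.points) where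
  toFun z := ⟨fun j => eval (z : Fin Z.n → ℂ) (f j), hfZ _ z.2⟩
  continuous_toFun := Continuous.subtype_mk
    (continuous_pi fun j => (continuous_eval (f j)).comp continuous_subtype_val) _

/-- Values of `soloInformedMapPoints` (definitional). -/
@[simp] theorem soloInformedMapPoints_apply_coe (z : Z.points) :
    ((soloInformedMapPoints f hfZ z : Z'.points) : Fin Z'.n → ℂ) =
      fun j => eval (z : Fin Z.n → ℂ) (f j) := rfl

/-- **`γ₀ ~ γ₁ ⟹ f ∘ γ₀ ~ f ∘ γ₁`.** [folklore: `Path.Homotopic.map`] -/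
theorem SoloInformedHomotopic.mapPath {γ₀ γ₁ : CurvePath Z} (hγ : SoloInformedHomotopic γ₀ γ₁) :
    SoloInformedHomotopic (soloInformedMapPath f hf hfZ γ₀) (soloInformedMapPath f hf hfZ γ₁) := by
  obtain ⟨x, y, p₀, p₁, h₀, h₁, hp⟩ := hγ
  refine ⟨_, _, p₀.map (soloInformedMapPoints f hfZ).continuous,
    p₁.map (soloInformedMapPoints f hfZ).continuous, fun t => ?_, fun t => ?_,
    hp.map (soloInformedMapPoints f hfZ)⟩
  · rw [soloInformedMapPath_apply, h₀ t]; rfl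
  · rw [soloInformedMapPath_apply, h₁ t]; rfl

end MapPath

/-! ## 4. (R4) for `κ` -/

/-- **(R4) for `κ` is a theorem under (APPROX) and (HI).** [Huber–Wüstholz 2022, §13.1 (B);
paper/rung2-v2.md §5] -/
theorem soloInformed_kappaR4 (hA : SoloInformedNashApprox) (hI : SoloInformedNashHI) :
    SoloInformedKappaR4 hA := by
  intro Z Z' hZ hZ' f hf hfZ ω' h' ω h hω γ γ' hγ'
  subst hω
  rw [soloInformedKappa_mk, soloInformedKappa_mk]
  have hNn := soloInformedNashRepl_nash hA hZ γ
  have hMn := soloInformed_isNashPath_mapPath f hf hfZ _ hNn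
  -- `f ∘ N(Z,γ) ~ f ∘ γ = γ′ ~ N(Z′,γ′)`
  have hhom : SoloInformedHomotopic (soloInformedMapPath f hf hfZ (soloInformedNashRepl hA hZ γ))
      (soloInformedNashRepl hA hZ' γ') := by
    refine ((SoloInformedHomotopic.mapPath f hf hfZ
      (soloInformedNashRepl_homotopic hA hZ γ)).symm.trans ?_).trans
      (soloInformedNashRepl_homotopic hA hZ' γ')
    exact (SoloInformedHomotopic.of_eqOn fun t ht => by
      rw [soloInformedMapPath_apply, hγ' t ht]).symm
  rw [soloInformedKappaTilde_mapPath f hf hfZ hZ hZ' ω' h' h _ hNn hMn]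
  exact hI Z' hZ' ω' h' _ _ hMn (soloInformedNashRepl_nash hA hZ' γ') hhom

/-- **Rung 2 from (HW), (APPROX), (HI), (R5).** -/
theorem soloInformed_volumeRung_two_of_nash' (hA : SoloInformedNashApprox) (hI : SoloInformedNashHI)
    (h5 : SoloInformedKappaR5 hA) (hHW : HuberWustholzCurvePeriods) : SoloInformedVolumeRung 2 :=
  soloInformed_volumeRung_two_of_nash hA hI (soloInformed_kappaR4 hA hI) h5 hHW

end Summit.KontsevichZagierPeriods.KontsevichZagierPeriods.Theorems
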